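import Summits.BirchSwinnertonDyer.BirchSwinnertonDyer.Theorems.QuadraticBranchSignedControlPlusEtaNonsurjCMAnchorInert
import Summits.BirchSwinnertonDyer.Rank1Residual.Partition.MainConjecturesCMInert
import Literature.NumberTheory.EllipticCurves.ZywinaCMImageProofs
import HarnessLib

/-!
# Route `QuadraticBranchSignedControl` (rung K8, cell `bsd-potss`): crux stmt-BirchSwinnertonDyer-19606
# `PlusEtaMainConjectureNonsurj` — THE CM ROWS AT EVERY PRIME `p ≥ 5`: a globally minimal CM curve good at `p` is a row IFF `p` is INERT in its
# CM field (Deuring, both directions, kernel); hence the CM populations at `p = 5, 7, 11` are explicit lists of `9, 7, 7` `j`-classes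

WHAT. The CM branch of skeleton v7 (`stub_conjA_partners_cm`, `stub_analyticEtaMu_cm`) quantifies over the CM rows of crux 19606: globally minimal
CM curves `V/ℚ`, good at `p ≥ 5`, with `a_p(V) = 0` and `p`-adic tower not onto. k8eta-c2 g14 proved ⟹: such a row has `p` INERT in its CM field
(`EtaCartanField.cmInert_of_cmAnchor`, Deuring by name). This file closes the loop:

* §1 `cmRow_iff_cmInert` (any `p ≥ 5`, kernel, no named fact): **for `V` globally minimal, good at `p`, with CM: `(a_p(V) = 0 ∧ tower not onto)
  ⟺ CMInert V p`** — ⟸ is Deuring at an inert good prime (the tree THEOREM `Rank1Residual.frobeniusTrace_eq_zero_of_hasCM_of_cmInert`, every CM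
  order) and Zywina (`not_hasSurjectiveModNGaloisRep_of_hasCM`: a CM curve is never tower-onto). So the CM population of the crux at `p` is
  EXACTLY «globally minimal, good at `p`, `j ∈ S_p`» with `S_p = {j ∈ cmJInvariants : p inert in ℚ(√d_K(j))}` — all the quadratic (for `j ∈ {0, 1728}`
  also sextic / quartic) twists unramified at `p` of finitely many CM curves.
* §2 the lists at the three census primes of the lineage (kernel tables, `decide`): `cmInert_five_iff_j_mem` — `S₅ = {0, 54000, −12288000, −3375,
  16581375, 8000, −884736000, −147197952000, −262537412640768000}` (9 classes; `d_K ∈ {−3, −7, −8, −43, −67, −163}`, g14's list);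
  `cmInert_seven_iff_j_mem` — `S₇ = {1728, 287496, 8000, −32768, −884736000, −147197952000, −262537412640768000}` (7; `d_K ∈ {−4, −8, −11, −43, −67,
  −163}`; `−7` ramified, `−3, −19` split); `cmInert_eleven_iff_j_mem` — `S₁₁ = {0, 54000, −12288000, 1728, 287496, −147197952000,
  −262537412640768000}` (7; `d_K ∈ {−3, −4, −67, −163}`; `−11` ramified) — matching the 7 CM points of `X_ns⁺(7)` (Zywina) and of `X_ns⁺(11)`
  (k8eta-c2 g16: orders `−16, −27, −12, −67, −4, −3, −163`); and `cmRow_five/seven/eleven_iff_j_mem`. (`p = 13, 17`: sibling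
  `…BDMTVPrimesDeuring`, where BDMTV makes ALL rows CM.)

HONEST FRAMING (cell `bsd-potss`, run/shared/lean/pub/bsd-potss/; FULL-BSD rank ≤ 1 programme): structure / bookkeeping theorems; no definition,
no named fact, no `sorry`, axioms standard; everything here is unconditional. Nothing about (C1⁺_η), (A) or the analytic `μ` is proved; crux 19606
stays OPEN; `BSD(W, p)` is claimed for no pair. Seat `bsd-potss-k8eta-c2` g17 (prover), `--supports stmt-BirchSwinnertonDyer-19606`.

References: [Lang1987] Ch. 13 §4 Thm. 12 (Deuring); [Cox2013] Prop. 5.16 / Cor. 5.17; [SilvermanAdvancedTopics1994] App. A §3; [Zywina2015]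
Prop. 1.14, §4 (`X_ns⁺(5)`, `X_ns⁺(7)`); [DoseFernandezGonzalezSchoof2014] §2 (`X_ns⁺(11)`); [Serre1972] §1.11 Prop. 12.
-/

set_option autoImplicit false
set_option linter.dupNamespace false

noncomputable section

open scoped Classical

open WeierstrassCurve Literature.NumberTheory.EllipticCurves Literature.NumberTheory.EllipticCurves.Rank1Residual

namespace Summit.BirchSwinnertonDyer.BirchSwinnertonDyer.Theorems.EtaCartanField

/-! ## §1 CM rows ⟺ `p` inert (any `p ≥ 5`) -/

/-- **The CM rows of crux 19606 at a prime `p ≥ 5` are exactly the globally minimal CM curves good at `p` with `p` INERT in the CM field.**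
For `V/ℚ` globally minimal, good at `p ≥ 5`, with CM: `(a_p(V) = 0 ∧ ¬ ∀ m, ρ_{V,p^m} onto) ⟺ CMInert V p`. ⟹ `cmInert_of_cmAnchor` (Deuring,
ordinary half + ramified exclusion); ⟸ Deuring at an inert good odd prime (`Rank1Residual.frobeniusTrace_eq_zero_of_hasCM_of_cmInert`) and
Zywina (CM ⟹ `ρ̄_{V,p}` not onto). [cite: Lang1987, Ch. 13 §4 Thm. 12] [cite: Zywina2015, Prop. 1.14] -/
theorem cmRow_iff_cmInert (V : WeierstrassCurve ℚ) [V.IsElliptic] [V.IsGloballyMinimal] (p : ℕ) [Fact p.Prime] (hp5 : 5 ≤ p)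
    (hgood : V.HasGoodReductionAtPrime p) (hCM : V.HasCM) :
    (V.frobeniusTrace p = 0 ∧ ¬ ∀ m : ℕ, V.HasSurjectiveModNGaloisRep (p ^ m : ℕ)) ↔ CMInert V p := by
  have hp2 : p ≠ 2 := by omega
  refine ⟨fun h => cmInert_of_cmAnchor V p hp5 hCM hgood h.1, fun hin => ⟨?_, fun h => ?_⟩⟩
  · exact Summit.BirchSwinnertonDyer.Rank1Residual.frobeniusTrace_eq_zero_of_hasCM_of_cmInert hCM hp2 hgood hin
  · exact V.not_hasSurjectiveModNGaloisRep_of_hasCM hCM Fact.out hp2 (by simpa using h 1)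

/-! ## §2 The CM populations at `p = 5, 7, 11` as explicit `j`-lists -/

/-- **At `p = 5`: for a CM curve, `5` is INERT in the CM field iff `j ∈ S_5`** (`S_5` = the 9 CM `j`-invariants whose order has
`5` inert; the others are split or ramified at `5` — kernel table `cmFieldDiscrOfJ` + quadratic residues mod `5`, `decide`).
[cite: SilvermanAdvancedTopics1994, App. A §3] [cite: Cox2013, Prop. 5.16 and Cor. 5.17] -/
theorem cmInert_five_iff_j_mem (V : WeierstrassCurve ℚ) [V.IsElliptic] (hCM : V.HasCM) :
    CMInert V 5 ↔ V.j ∈ ({0, -3375, 8000, 54000, -12288000, 16581375, -884736000, -147197952000, -262537412640768000} : Finset ℚ) := by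
  have hj := (hasCM_iff_j_mem_holds V).mp hCM
  unfold CMInert CMRamified CMSplit
  simp only [cmJInvariants, Finset.mem_insert, Finset.mem_singleton] at hj ⊢
  rcases hj with h | h | h | h | h | h | h | h | h | h | h | h | h
  · have hd : cmFieldDiscrOfJ V.j = -3 := by rw [h]; norm_num [cmFieldDiscrOfJ]
    rw [hd, if_neg (by decide)]
    exact ⟨fun _ => by rw [h]; norm_num, fun _ => ⟨by decide, by rintro ⟨-, r, hr⟩; revert r hr; decide⟩⟩
  · have hd : cmFieldDiscrOfJ V.j = -4 := by rw [h]; norm_num [cmFieldDiscrOfJ]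
    rw [hd, if_neg (by decide)]
    exact ⟨fun hi => absurd ⟨by decide, ⟨1, by decide⟩⟩ hi.2, fun hm => by rw [h] at hm; norm_num at hm⟩
  · have hd : cmFieldDiscrOfJ V.j = -7 := by rw [h]; norm_num [cmFieldDiscrOfJ]
    rw [hd, if_neg (by decide)]
    exact ⟨fun _ => by rw [h]; norm_num, fun _ => ⟨by decide, by rintro ⟨-, r, hr⟩; revert r hr; decide⟩⟩
  · have hd : cmFieldDiscrOfJ V.j = -8 := by rw [h]; norm_num [cmFieldDiscrOfJ]
    rw [hd, if_neg (by decide)]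
    exact ⟨fun _ => by rw [h]; norm_num, fun _ => ⟨by decide, by rintro ⟨-, r, hr⟩; revert r hr; decide⟩⟩
  · have hd : cmFieldDiscrOfJ V.j = -11 := by rw [h]; norm_num [cmFieldDiscrOfJ]
    rw [hd, if_neg (by decide)]
    exact ⟨fun hi => absurd ⟨by decide, ⟨2, by decide⟩⟩ hi.2, fun hm => by rw [h] at hm; norm_num at hm⟩
  · have hd : cmFieldDiscrOfJ V.j = -3 := by rw [h]; norm_num [cmFieldDiscrOfJ]
    rw [hd, if_neg (by decide)]
    exact ⟨fun _ => by rw [h]; norm_num, fun _ => ⟨by decide, by rintro ⟨-, r, hr⟩; revert r hr; decide⟩⟩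
  · have hd : cmFieldDiscrOfJ V.j = -4 := by rw [h]; norm_num [cmFieldDiscrOfJ]
    rw [hd, if_neg (by decide)]
    exact ⟨fun hi => absurd ⟨by decide, ⟨1, by decide⟩⟩ hi.2, fun hm => by rw [h] at hm; norm_num at hm⟩
  · have hd : cmFieldDiscrOfJ V.j = -19 := by rw [h]; norm_num [cmFieldDiscrOfJ]
    rw [hd, if_neg (by decide)]
    exact ⟨fun hi => absurd ⟨by decide, ⟨1, by decide⟩⟩ hi.2, fun hm => by rw [h] at hm; norm_num at hm⟩
  · have hd : cmFieldDiscrOfJ V.j = -3 := by rw [h]; norm_num [cmFieldDiscrOfJ]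
    rw [hd, if_neg (by decide)]
    exact ⟨fun _ => by rw [h]; norm_num, fun _ => ⟨by decide, by rintro ⟨-, r, hr⟩; revert r hr; decide⟩⟩
  · have hd : cmFieldDiscrOfJ V.j = -7 := by rw [h]; norm_num [cmFieldDiscrOfJ]
    rw [hd, if_neg (by decide)]
    exact ⟨fun _ => by rw [h]; norm_num, fun _ => ⟨by decide, by rintro ⟨-, r, hr⟩; revert r hr; decide⟩⟩
  · have hd : cmFieldDiscrOfJ V.j = -43 := by rw [h]; norm_num [cmFieldDiscrOfJ]
    rw [hd, if_neg (by decide)]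
    exact ⟨fun _ => by rw [h]; norm_num, fun _ => ⟨by decide, by rintro ⟨-, r, hr⟩; revert r hr; decide⟩⟩
  · have hd : cmFieldDiscrOfJ V.j = -67 := by rw [h]; norm_num [cmFieldDiscrOfJ]
    rw [hd, if_neg (by decide)]
    exact ⟨fun _ => by rw [h]; norm_num, fun _ => ⟨by decide, by rintro ⟨-, r, hr⟩; revert r hr; decide⟩⟩
  · have hd : cmFieldDiscrOfJ V.j = -163 := by rw [h]; norm_num [cmFieldDiscrOfJ]
    rw [hd, if_neg (by decide)]
    exact ⟨fun _ => by rw [h]; norm_num, fun _ => ⟨by decide, by rintro ⟨-, r, hr⟩; revert r hr; decide⟩⟩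

/-- **THE CM ROWS OF CRUX 19606 AT `p = 5`, exactly.** For `V/ℚ` globally minimal, good at `5`, WITH CM: `V` is a row (`a_5(V) = 0` and the
`5`-adic tower is not onto) IFF `j(V) ∈ S_5` (9 classes). ⟹ Deuring inert-at-anchor (k8eta-c2 g14 `cmInert_of_cmAnchor`); ⟸ Deuring
(`Rank1Residual.frobeniusTrace_eq_zero_of_hasCM_of_cmInert`) + Zywina. Kernel, no named fact. (At `5` NON-CM rows exist as well — the
`X_ns⁺(5)` census of the lineage; this statement classifies the CM population only.) [cite: Lang1987, Ch. 13 §4 Thm. 12] [cite: Zywina2015, Prop. 1.14] -/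
theorem cmRow_five_iff_j_mem (V : WeierstrassCurve ℚ) [V.IsElliptic] [V.IsGloballyMinimal] (p : ℕ) [Fact p.Prime] (hp : p = 5)
    (hgood : V.HasGoodReductionAtPrime p) (hCM : V.HasCM) :
    (V.frobeniusTrace p = 0 ∧ ¬ ∀ m : ℕ, V.HasSurjectiveModNGaloisRep (p ^ m : ℕ)) ↔ V.j ∈ ({0, -3375, 8000, 54000, -12288000, 16581375, -884736000, -147197952000, -262537412640768000} : Finset ℚ) := by
  rw [← cmInert_five_iff_j_mem V hCM, ← hp]
  exact cmRow_iff_cmInert V p (by omega) hgood hCM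

/-- **At `p = 7`: for a CM curve, `7` is INERT in the CM field iff `j ∈ S_7`** (`S_7` = the 7 CM `j`-invariants whose order has
`7` inert; the others are split or ramified at `7` — kernel table `cmFieldDiscrOfJ` + quadratic residues mod `7`, `decide`).
[cite: SilvermanAdvancedTopics1994, App. A §3] [cite: Cox2013, Prop. 5.16 and Cor. 5.17] -/
theorem cmInert_seven_iff_j_mem (V : WeierstrassCurve ℚ) [V.IsElliptic] (hCM : V.HasCM) :
    CMInert V 7 ↔ V.j ∈ ({1728, 8000, -32768, 287496, -884736000, -147197952000, -262537412640768000} : Finset ℚ) := by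
  have hj := (hasCM_iff_j_mem_holds V).mp hCM
  unfold CMInert CMRamified CMSplit
  simp only [cmJInvariants, Finset.mem_insert, Finset.mem_singleton] at hj ⊢
  rcases hj with h | h | h | h | h | h | h | h | h | h | h | h | h
  · have hd : cmFieldDiscrOfJ V.j = -3 := by rw [h]; norm_num [cmFieldDiscrOfJ]
    rw [hd, if_neg (by decide)]
    exact ⟨fun hi => absurd ⟨by decide, ⟨2, by decide⟩⟩ hi.2, fun hm => by rw [h] at hm; norm_num at hm⟩
  · have hd : cmFieldDiscrOfJ V.j = -4 := by rw [h]; norm_num [cmFieldDiscrOfJ]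
    rw [hd, if_neg (by decide)]
    exact ⟨fun _ => by rw [h]; norm_num, fun _ => ⟨by decide, by rintro ⟨-, r, hr⟩; revert r hr; decide⟩⟩
  · have hd : cmFieldDiscrOfJ V.j = -7 := by rw [h]; norm_num [cmFieldDiscrOfJ]
    rw [hd, if_neg (by decide)]
    exact ⟨fun hi => absurd (by decide) hi.1, fun hm => by rw [h] at hm; norm_num at hm⟩
  · have hd : cmFieldDiscrOfJ V.j = -8 := by rw [h]; norm_num [cmFieldDiscrOfJ]
    rw [hd, if_neg (by decide)]
    exact ⟨fun _ => by rw [h]; norm_num, fun _ => ⟨by decide, by rintro ⟨-, r, hr⟩; revert r hr; decide⟩⟩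
  · have hd : cmFieldDiscrOfJ V.j = -11 := by rw [h]; norm_num [cmFieldDiscrOfJ]
    rw [hd, if_neg (by decide)]
    exact ⟨fun _ => by rw [h]; norm_num, fun _ => ⟨by decide, by rintro ⟨-, r, hr⟩; revert r hr; decide⟩⟩
  · have hd : cmFieldDiscrOfJ V.j = -3 := by rw [h]; norm_num [cmFieldDiscrOfJ]
    rw [hd, if_neg (by decide)]
    exact ⟨fun hi => absurd ⟨by decide, ⟨2, by decide⟩⟩ hi.2, fun hm => by rw [h] at hm; norm_num at hm⟩
  · have hd : cmFieldDiscrOfJ V.j = -4 := by rw [h]; norm_num [cmFieldDiscrOfJ]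
    rw [hd, if_neg (by decide)]
    exact ⟨fun _ => by rw [h]; norm_num, fun _ => ⟨by decide, by rintro ⟨-, r, hr⟩; revert r hr; decide⟩⟩
  · have hd : cmFieldDiscrOfJ V.j = -19 := by rw [h]; norm_num [cmFieldDiscrOfJ]
    rw [hd, if_neg (by decide)]
    exact ⟨fun hi => absurd ⟨by decide, ⟨3, by decide⟩⟩ hi.2, fun hm => by rw [h] at hm; norm_num at hm⟩
  · have hd : cmFieldDiscrOfJ V.j = -3 := by rw [h]; norm_num [cmFieldDiscrOfJ]
    rw [hd, if_neg (by decide)]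
    exact ⟨fun hi => absurd ⟨by decide, ⟨2, by decide⟩⟩ hi.2, fun hm => by rw [h] at hm; norm_num at hm⟩
  · have hd : cmFieldDiscrOfJ V.j = -7 := by rw [h]; norm_num [cmFieldDiscrOfJ]
    rw [hd, if_neg (by decide)]
    exact ⟨fun hi => absurd (by decide) hi.1, fun hm => by rw [h] at hm; norm_num at hm⟩
  · have hd : cmFieldDiscrOfJ V.j = -43 := by rw [h]; norm_num [cmFieldDiscrOfJ]
    rw [hd, if_neg (by decide)]
    exact ⟨fun _ => by rw [h]; norm_num, fun _ => ⟨by decide, by rintro ⟨-, r, hr⟩; revert r hr; decide⟩⟩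
  · have hd : cmFieldDiscrOfJ V.j = -67 := by rw [h]; norm_num [cmFieldDiscrOfJ]
    rw [hd, if_neg (by decide)]
    exact ⟨fun _ => by rw [h]; norm_num, fun _ => ⟨by decide, by rintro ⟨-, r, hr⟩; revert r hr; decide⟩⟩
  · have hd : cmFieldDiscrOfJ V.j = -163 := by rw [h]; norm_num [cmFieldDiscrOfJ]
    rw [hd, if_neg (by decide)]
    exact ⟨fun _ => by rw [h]; norm_num, fun _ => ⟨by decide, by rintro ⟨-, r, hr⟩; revert r hr; decide⟩⟩

/-- **THE CM ROWS OF CRUX 19606 AT `p = 7`, exactly.** For `V/ℚ` globally minimal, good at `7`, WITH CM: `V` is a row (`a_7(V) = 0` and the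
`7`-adic tower is not onto) IFF `j(V) ∈ S_7` (7 classes). ⟹ Deuring inert-at-anchor (k8eta-c2 g14 `cmInert_of_cmAnchor`); ⟸ Deuring
(`Rank1Residual.frobeniusTrace_eq_zero_of_hasCM_of_cmInert`) + Zywina. Kernel, no named fact. (At `7` NON-CM rows exist as well — the
`X_ns⁺(7)` census of the lineage; this statement classifies the CM population only.) [cite: Lang1987, Ch. 13 §4 Thm. 12] [cite: Zywina2015, Prop. 1.14] -/
theorem cmRow_seven_iff_j_mem (V : WeierstrassCurve ℚ) [V.IsElliptic] [V.IsGloballyMinimal] (p : ℕ) [Fact p.Prime] (hp : p = 7)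
    (hgood : V.HasGoodReductionAtPrime p) (hCM : V.HasCM) :
    (V.frobeniusTrace p = 0 ∧ ¬ ∀ m : ℕ, V.HasSurjectiveModNGaloisRep (p ^ m : ℕ)) ↔ V.j ∈ ({1728, 8000, -32768, 287496, -884736000, -147197952000, -262537412640768000} : Finset ℚ) := by
  rw [← cmInert_seven_iff_j_mem V hCM, ← hp]
  exact cmRow_iff_cmInert V p (by omega) hgood hCM

/-- **At `p = 11`: for a CM curve, `11` is INERT in the CM field iff `j ∈ S_11`** (`S_11` = the 7 CM `j`-invariants whose order has
`11` inert; the others are split or ramified at `11` — kernel table `cmFieldDiscrOfJ` + quadratic residues mod `11`, `decide`).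
[cite: SilvermanAdvancedTopics1994, App. A §3] [cite: Cox2013, Prop. 5.16 and Cor. 5.17] -/
theorem cmInert_eleven_iff_j_mem (V : WeierstrassCurve ℚ) [V.IsElliptic] (hCM : V.HasCM) :
    CMInert V 11 ↔ V.j ∈ ({0, 1728, 54000, 287496, -12288000, -147197952000, -262537412640768000} : Finset ℚ) := by
  have hj := (hasCM_iff_j_mem_holds V).mp hCM
  unfold CMInert CMRamified CMSplit
  simp only [cmJInvariants, Finset.mem_insert, Finset.mem_singleton] at hj ⊢
  rcases hj with h | h | h | h | h | h | h | h | h | h | h | h | h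
  · have hd : cmFieldDiscrOfJ V.j = -3 := by rw [h]; norm_num [cmFieldDiscrOfJ]
    rw [hd, if_neg (by decide)]
    exact ⟨fun _ => by rw [h]; norm_num, fun _ => ⟨by decide, by rintro ⟨-, r, hr⟩; revert r hr; decide⟩⟩
  · have hd : cmFieldDiscrOfJ V.j = -4 := by rw [h]; norm_num [cmFieldDiscrOfJ]
    rw [hd, if_neg (by decide)]
    exact ⟨fun _ => by rw [h]; norm_num, fun _ => ⟨by decide, by rintro ⟨-, r, hr⟩; revert r hr; decide⟩⟩
  · have hd : cmFieldDiscrOfJ V.j = -7 := by rw [h]; norm_num [cmFieldDiscrOfJ]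
    rw [hd, if_neg (by decide)]
    exact ⟨fun hi => absurd ⟨by decide, ⟨2, by decide⟩⟩ hi.2, fun hm => by rw [h] at hm; norm_num at hm⟩
  · have hd : cmFieldDiscrOfJ V.j = -8 := by rw [h]; norm_num [cmFieldDiscrOfJ]
    rw [hd, if_neg (by decide)]
    exact ⟨fun hi => absurd ⟨by decide, ⟨5, by decide⟩⟩ hi.2, fun hm => by rw [h] at hm; norm_num at hm⟩
  · have hd : cmFieldDiscrOfJ V.j = -11 := by rw [h]; norm_num [cmFieldDiscrOfJ]
    rw [hd, if_neg (by decide)]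
    exact ⟨fun hi => absurd (by decide) hi.1, fun hm => by rw [h] at hm; norm_num at hm⟩
  · have hd : cmFieldDiscrOfJ V.j = -3 := by rw [h]; norm_num [cmFieldDiscrOfJ]
    rw [hd, if_neg (by decide)]
    exact ⟨fun _ => by rw [h]; norm_num, fun _ => ⟨by decide, by rintro ⟨-, r, hr⟩; revert r hr; decide⟩⟩
  · have hd : cmFieldDiscrOfJ V.j = -4 := by rw [h]; norm_num [cmFieldDiscrOfJ]
    rw [hd, if_neg (by decide)]
    exact ⟨fun _ => by rw [h]; norm_num, fun _ => ⟨by decide, by rintro ⟨-, r, hr⟩; revert r hr; decide⟩⟩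
  · have hd : cmFieldDiscrOfJ V.j = -19 := by rw [h]; norm_num [cmFieldDiscrOfJ]
    rw [hd, if_neg (by decide)]
    exact ⟨fun hi => absurd ⟨by decide, ⟨5, by decide⟩⟩ hi.2, fun hm => by rw [h] at hm; norm_num at hm⟩
  · have hd : cmFieldDiscrOfJ V.j = -3 := by rw [h]; norm_num [cmFieldDiscrOfJ]
    rw [hd, if_neg (by decide)]
    exact ⟨fun _ => by rw [h]; norm_num, fun _ => ⟨by decide, by rintro ⟨-, r, hr⟩; revert r hr; decide⟩⟩
  · have hd : cmFieldDiscrOfJ V.j = -7 := by rw [h]; norm_num [cmFieldDiscrOfJ]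
    rw [hd, if_neg (by decide)]
    exact ⟨fun hi => absurd ⟨by decide, ⟨2, by decide⟩⟩ hi.2, fun hm => by rw [h] at hm; norm_num at hm⟩
  · have hd : cmFieldDiscrOfJ V.j = -43 := by rw [h]; norm_num [cmFieldDiscrOfJ]
    rw [hd, if_neg (by decide)]
    exact ⟨fun hi => absurd ⟨by decide, ⟨1, by decide⟩⟩ hi.2, fun hm => by rw [h] at hm; norm_num at hm⟩
  · have hd : cmFieldDiscrOfJ V.j = -67 := by rw [h]; norm_num [cmFieldDiscrOfJ]
    rw [hd, if_neg (by decide)]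
    exact ⟨fun _ => by rw [h]; norm_num, fun _ => ⟨by decide, by rintro ⟨-, r, hr⟩; revert r hr; decide⟩⟩
  · have hd : cmFieldDiscrOfJ V.j = -163 := by rw [h]; norm_num [cmFieldDiscrOfJ]
    rw [hd, if_neg (by decide)]
    exact ⟨fun _ => by rw [h]; norm_num, fun _ => ⟨by decide, by rintro ⟨-, r, hr⟩; revert r hr; decide⟩⟩

/-- **THE CM ROWS OF CRUX 19606 AT `p = 11`, exactly.** For `V/ℚ` globally minimal, good at `11`, WITH CM: `V` is a row (`a_11(V) = 0` and the
`11`-adic tower is not onto) IFF `j(V) ∈ S_11` (7 classes). ⟹ Deuring inert-at-anchor (k8eta-c2 g14 `cmInert_of_cmAnchor`); ⟸ Deuring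
(`Rank1Residual.frobeniusTrace_eq_zero_of_hasCM_of_cmInert`) + Zywina. Kernel, no named fact. (At `11` NON-CM rows exist as well — the
`X_ns⁺(11)` census of the lineage; this statement classifies the CM population only.) [cite: Lang1987, Ch. 13 §4 Thm. 12] [cite: Zywina2015, Prop. 1.14] -/
theorem cmRow_eleven_iff_j_mem (V : WeierstrassCurve ℚ) [V.IsElliptic] [V.IsGloballyMinimal] (p : ℕ) [Fact p.Prime] (hp : p = 11)
    (hgood : V.HasGoodReductionAtPrime p) (hCM : V.HasCM) :
    (V.frobeniusTrace p = 0 ∧ ¬ ∀ m : ℕ, V.HasSurjectiveModNGaloisRep (p ^ m : ℕ)) ↔ V.j ∈ ({0, 1728, 54000, 287496, -12288000, -147197952000, -262537412640768000} : Finset ℚ) := by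
  rw [← cmInert_eleven_iff_j_mem V hCM, ← hp]
  exact cmRow_iff_cmInert V p (by omega) hgood hCM

end Summit.BirchSwinnertonDyer.BirchSwinnertonDyer.Theorems.EtaCartanField

end
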